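import Summits.QuantumAdvantage.QuantumAdvantage.Theorems.CubicForrelationNearExactIsExactCubicFormR4ZLeafFrame

/-!
# Crux `CubicForrelation.NearExactIsExact` (stmt-QuantumAdvantage-14043) — E1280-even, R4 branch, the d-level leaf of descendant `0`:
  the SLICES of the transported cubic form in the language of …TwelvePartnerR4LeafZ

Certificate seat `b2b-cforr-cert` (gen 43).  HONEST FRAMING: kernel-checked bookkeeping (standard axioms), tool 5 for the leaf statement
`HLEAF` of …CubicFormR4ZReduce: from the ten block entries of …CubicFormR4ZLeafFrame and the symmetry of the transported tensor `d'`,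
the twelve slice hypotheses `hdy_κκ … hdz_σσ` of the section `R4ZLeaf` of …TwelvePartnerR4LeafZ, with `Ξ'_{su} = (Rᵀ Ξ R)_{su}` and
`Y_t(s) = Σ M_{t'j} (b_{t+1})_{t'} (r_s)_j`.  Index bookkeeping only (`κ1 = v₀' ↔ b₀`, `κ(2+t) = v_{t+1}' ↔ b_{t+1}`).  Nothing about
`θ₁₂`; NOT summit progress.

References: this seat lineage (g39 HANDPROOFS §2.4, g43 LEAN-GEN43).  Axioms: the standard three.
-/

set_option linter.dupNamespace false -- D-0017: single-problem summit ⇒ `QuantumAdvantage.QuantumAdvantage` by design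

namespace Summit.QuantumAdvantage.QuantumAdvantage.Theorems.CubicForrelation.NearExactIsExact

open Finset

/-- `1 = succ 0` in `Fin 5`. [trivial] -/
theorem tq5_k1 : (1 : Fin 5) = Fin.succ 0 := rfl

/-- `2 + t = succ (succ t)` in `Fin 5`. [trivial] -/
theorem tq5_knat (t : Fin 3) : (Fin.natAdd 2 t : Fin 5) = Fin.succ (Fin.succ t) :=
  Fin.ext (by simp only [Fin.val_natAdd, Fin.val_succ]; omega)

/-- `0 ≠ succ x` in `Fin 5`, as a rewrite rule. [trivial] -/
theorem tq5_h0s5 (x : Fin 4) : ((0 : Fin 5) = Fin.succ x) ↔ False := ⟨fun h => Fin.succ_ne_zero x h.symm, False.elim⟩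

/-- `0 ≠ succ x` in `Fin 4`, as a rewrite rule. [trivial] -/
theorem tq5_h0s4 (x : Fin 3) : ((0 : Fin 4) = Fin.succ x) ↔ False := ⟨fun h => Fin.succ_ne_zero x h.symm, False.elim⟩

section Slices

variable (d : Fin (5 + 7) → Fin (5 + 7) → Fin (5 + 7) → ZMod 2) (hds : ∀ φ j k, d φ k j = d φ j k) (hdc : ∀ φ j k, d j φ k = d φ j k) (hdd : ∀ φ j, d φ j j = 0)
  (hF : ∀ j k, d (Fin.castAdd 7 (0 : Fin 5)) j k =
      (if (j = Fin.castAdd 7 (1 : Fin 5) ∧ k = Fin.castAdd 7 (2 : Fin 5)) ∨ (j = Fin.castAdd 7 (2 : Fin 5) ∧ k = Fin.castAdd 7 (1 : Fin 5)) then 1 else 0) +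
      (if (j = Fin.castAdd 7 (3 : Fin 5) ∧ k = Fin.castAdd 7 (4 : Fin 5)) ∨ (j = Fin.castAdd 7 (4 : Fin 5) ∧ k = Fin.castAdd 7 (3 : Fin 5)) then 1 else 0))
  (hzzz : ∀ σ τ υ : Fin 7, d (Fin.natAdd 5 σ) (Fin.natAdd 5 τ) (Fin.natAdd 5 υ) = 0) (a : Fin 4 → ZMod 2) (Ξ : Fin 7 → Fin 7 → ZMod 2)
  (hdΞ : ∀ (t : Fin 4) (j k : Fin 7), d (Fin.castAdd 7 t.succ) (Fin.natAdd 5 j) (Fin.natAdd 5 k) = a t * Ξ j k)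
  (E : Fin 7 → ZMod 2) (M : Fin 4 → Fin 7 → ZMod 2)
  (hdL : ∀ (t t' : Fin 4) (j : Fin 7), d (Fin.castAdd 7 t.succ) (Fin.castAdd 7 t'.succ) (Fin.natAdd 5 j) =
      ((if (t = 0 ∧ t' = 1) ∨ (t = 1 ∧ t' = 0) then (1 : ZMod 2) else 0) + (if (t = 2 ∧ t' = 3) ∨ (t = 3 ∧ t' = 2) then (1 : ZMod 2) else 0)) * E j + a t * M t' j + a t' * M t j)
  (BC : Fin 4 → Fin 4 → ZMod 2) (RC : Fin 7 → Fin 7 → ZMod 2) (β : Fin 4 → ZMod 2) (ε : Fin 7 → ZMod 2)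
  (P : Fin (5 + 7) → Fin (5 + 7) → ZMod 2)
include hds hdc hdd hF hzzz hdΞ hdL

/-- Slice `hdy_κκ`: `d'(y, κa, κb) = ω` on the `v`-block. [this work] -/
theorem tq5_s_dy_kk (d' : Fin (5 + 7) → Fin (5 + 7) → Fin (5 + 7) → ZMod 2) (hd' : ∀ φ j k, d' φ j k = (∑ ψ, ∑ α, ∑ β', P ψ φ * P α j * P β' k * d ψ α β'))
    (hds' : ∀ φ j k, d' φ k j = d' φ j k)
    (hP0 : ∀ ψ, P ψ (Fin.castAdd 7 (0 : Fin 5)) = (Fin.append (Fin.cons (1) ((0 : Fin 4 → ZMod 2)) : Fin 5 → ZMod 2) ((0 : Fin 7 → ZMod 2)) : Fin (5 + 7) → ZMod 2) ψ)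
    (hPv : ∀ ψ (i : Fin 4), P ψ (Fin.castAdd 7 (Fin.succ i)) = (Fin.append (Fin.cons (β i) (BC i) : Fin 5 → ZMod 2) ((0 : Fin 7 → ZMod 2)) : Fin (5 + 7) → ZMod 2) ψ)
    (hBω : ∀ i i' : Fin 4, (∑ t : Fin 4, ∑ t' : Fin 4, BC i t * BC i' t' * ((if (t = 0 ∧ t' = 1) ∨ (t = 1 ∧ t' = 0) then (1 : ZMod 2) else 0) + (if (t = 2 ∧ t' = 3) ∨ (t = 3 ∧ t' = 2) then (1 : ZMod 2) else 0))) = ((if (i = 0 ∧ i' = 1) ∨ (i = 1 ∧ i' = 0) then (1 : ZMod 2) else 0) + (if (i = 2 ∧ i' = 3) ∨ (i = 3 ∧ i' = 2) then (1 : ZMod 2) else 0))) :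
    ∀ a₁ b₁ : Fin 5, d' (Fin.castAdd 7 0) (Fin.castAdd 7 a₁) (Fin.castAdd 7 b₁) =
      (if (a₁ = 1 ∧ b₁ = 2) ∨ (a₁ = 2 ∧ b₁ = 1) then 1 else 0) + (if (a₁ = 3 ∧ b₁ = 4) ∨ (a₁ = 4 ∧ b₁ = 3) then 1 else 0) := by
  intro a₁ b₁
  induction a₁ using Fin.cases with
  | zero =>
    induction b₁ using Fin.cases with
    | zero => rw [hd', tq5_e_yyy d hds hdc hdd hF hzzz a Ξ hdΞ E M hdL P  hP0]; decide
    | succ i' => rw [hd', tq5_e_yyv d hds hdc hdd hF hzzz a Ξ hdΞ E M hdL BC β P i' hP0 hPv]; revert i'; decide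
  | succ i =>
    induction b₁ using Fin.cases with
    | zero => rw [hds', hd', tq5_e_yyv d hds hdc hdd hF hzzz a Ξ hdΞ E M hdL BC β P i hP0 hPv]; revert i; decide
    | succ i' => rw [hd', tq5_e_yvv d hds hdc hdd hF hzzz a Ξ hdΞ E M hdL BC β P i i' hP0 hPv hBω]; revert i i'; decide

/-- Slice `hdy_κσ`: `d'(y, κa, z') = 0`. [this work] -/
theorem tq5_s_dy_ks (d' : Fin (5 + 7) → Fin (5 + 7) → Fin (5 + 7) → ZMod 2) (hd' : ∀ φ j k, d' φ j k = (∑ ψ, ∑ α, ∑ β', P ψ φ * P α j * P β' k * d ψ α β'))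
    (hP0 : ∀ ψ, P ψ (Fin.castAdd 7 (0 : Fin 5)) = (Fin.append (Fin.cons (1) ((0 : Fin 4 → ZMod 2)) : Fin 5 → ZMod 2) ((0 : Fin 7 → ZMod 2)) : Fin (5 + 7) → ZMod 2) ψ)
    (hPv : ∀ ψ (i : Fin 4), P ψ (Fin.castAdd 7 (Fin.succ i)) = (Fin.append (Fin.cons (β i) (BC i) : Fin 5 → ZMod 2) ((0 : Fin 7 → ZMod 2)) : Fin (5 + 7) → ZMod 2) ψ)
    (hPz : ∀ ψ (j : Fin 7), P ψ (Fin.natAdd 5 j) = (Fin.append (Fin.cons (ε j) ((0 : Fin 4 → ZMod 2)) : Fin 5 → ZMod 2) (RC j) : Fin (5 + 7) → ZMod 2) ψ) :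
    ∀ (a₁ : Fin 5) (s : Fin 7), d' (Fin.castAdd 7 0) (Fin.castAdd 7 a₁) (Fin.natAdd 5 s) = 0 := by
  intro a₁ s
  induction a₁ using Fin.cases with
  | zero => rw [hd', tq5_e_yyz d hds hdc hdd hF hzzz a Ξ hdΞ E M hdL RC ε P s hP0 hPz]
  | succ i => rw [hd', tq5_e_yvz d hds hdc hdd hF hzzz a Ξ hdΞ E M hdL BC RC β ε P i s hP0 hPv hPz]

/-- Slice `hdy_σσ`: `d'(y, z', z') = 0`. [this work] -/
theorem tq5_s_dy_ss (d' : Fin (5 + 7) → Fin (5 + 7) → Fin (5 + 7) → ZMod 2) (hd' : ∀ φ j k, d' φ j k = (∑ ψ, ∑ α, ∑ β', P ψ φ * P α j * P β' k * d ψ α β'))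
    (hP0 : ∀ ψ, P ψ (Fin.castAdd 7 (0 : Fin 5)) = (Fin.append (Fin.cons (1) ((0 : Fin 4 → ZMod 2)) : Fin 5 → ZMod 2) ((0 : Fin 7 → ZMod 2)) : Fin (5 + 7) → ZMod 2) ψ)
    (hPz : ∀ ψ (j : Fin 7), P ψ (Fin.natAdd 5 j) = (Fin.append (Fin.cons (ε j) ((0 : Fin 4 → ZMod 2)) : Fin 5 → ZMod 2) (RC j) : Fin (5 + 7) → ZMod 2) ψ) :
    ∀ s u : Fin 7, d' (Fin.castAdd 7 0) (Fin.natAdd 5 s) (Fin.natAdd 5 u) = 0 := by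
  intro s u
  rw [hd', tq5_e_yzz d hds hdc hdd hF hzzz a Ξ hdΞ E M hdL RC ε P s u hP0 hPz]

/-- Slice `hdv0_κκ`: `d'(v₀', κa, κb) = [{a,b} = {y, v₁'}]`. [this work] -/
theorem tq5_s_dv0_kk (d' : Fin (5 + 7) → Fin (5 + 7) → Fin (5 + 7) → ZMod 2) (hd' : ∀ φ j k, d' φ j k = (∑ ψ, ∑ α, ∑ β', P ψ φ * P α j * P β' k * d ψ α β'))
    (hds' : ∀ φ j k, d' φ k j = d' φ j k)
    (hdc' : ∀ φ j k, d' j φ k = d' φ j k)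
    (hP0 : ∀ ψ, P ψ (Fin.castAdd 7 (0 : Fin 5)) = (Fin.append (Fin.cons (1) ((0 : Fin 4 → ZMod 2)) : Fin 5 → ZMod 2) ((0 : Fin 7 → ZMod 2)) : Fin (5 + 7) → ZMod 2) ψ)
    (hPv : ∀ ψ (i : Fin 4), P ψ (Fin.castAdd 7 (Fin.succ i)) = (Fin.append (Fin.cons (β i) (BC i) : Fin 5 → ZMod 2) ((0 : Fin 7 → ZMod 2)) : Fin (5 + 7) → ZMod 2) ψ)
    (hBω : ∀ i i' : Fin 4, (∑ t : Fin 4, ∑ t' : Fin 4, BC i t * BC i' t' * ((if (t = 0 ∧ t' = 1) ∨ (t = 1 ∧ t' = 0) then (1 : ZMod 2) else 0) + (if (t = 2 ∧ t' = 3) ∨ (t = 3 ∧ t' = 2) then (1 : ZMod 2) else 0))) = ((if (i = 0 ∧ i' = 1) ∨ (i = 1 ∧ i' = 0) then (1 : ZMod 2) else 0) + (if (i = 2 ∧ i' = 3) ∨ (i = 3 ∧ i' = 2) then (1 : ZMod 2) else 0)))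
    (hβ : ∀ i i' i'' : Fin 4, (∑ t : Fin 4, ∑ t' : Fin 4, ∑ t'' : Fin 4, BC i t * BC i' t' * BC i'' t'' * d (Fin.castAdd 7 (Fin.succ t)) (Fin.castAdd 7 (Fin.succ t')) (Fin.castAdd 7 (Fin.succ t''))) + β i * ((if (i' = 0 ∧ i'' = 1) ∨ (i' = 1 ∧ i'' = 0) then (1 : ZMod 2) else 0) + (if (i' = 2 ∧ i'' = 3) ∨ (i' = 3 ∧ i'' = 2) then (1 : ZMod 2) else 0)) + β i' * ((if (i = 0 ∧ i'' = 1) ∨ (i = 1 ∧ i'' = 0) then (1 : ZMod 2) else 0) + (if (i = 2 ∧ i'' = 3) ∨ (i = 3 ∧ i'' = 2) then (1 : ZMod 2) else 0)) + β i'' * ((if (i = 0 ∧ i' = 1) ∨ (i = 1 ∧ i' = 0) then (1 : ZMod 2) else 0) + (if (i = 2 ∧ i' = 3) ∨ (i = 3 ∧ i' = 2) then (1 : ZMod 2) else 0)) = 0) :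
    ∀ a₁ b₁ : Fin 5, d' (Fin.castAdd 7 1) (Fin.castAdd 7 a₁) (Fin.castAdd 7 b₁) = if (a₁ = 0 ∧ b₁ = 2) ∨ (a₁ = 2 ∧ b₁ = 0) then 1 else 0 := by
  intro a₁ b₁
  rw [tq5_k1]
  induction a₁ using Fin.cases with
  | zero =>
    induction b₁ using Fin.cases with
    | zero => rw [hdc', hds', hd', tq5_e_yyv d hds hdc hdd hF hzzz a Ξ hdΞ E M hdL BC β P 0 hP0 hPv]; decide
    | succ i' => rw [hdc', hd', tq5_e_yvv d hds hdc hdd hF hzzz a Ξ hdΞ E M hdL BC β P 0 i' hP0 hPv hBω]; revert i'; decide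
  | succ i =>
    induction b₁ using Fin.cases with
    | zero => rw [hds', hdc', hd', tq5_e_yvv d hds hdc hdd hF hzzz a Ξ hdΞ E M hdL BC β P 0 i hP0 hPv hBω]; revert i; decide
    | succ i' => rw [hd', tq5_e_vvv d hds hdc hdd hF hzzz a Ξ hdΞ E M hdL BC β P 0 i i' hPv hBω hβ]; revert i i'; decide

/-- Slice `hdv0_κσ`: `d'(v₀', κa, z'_s) = Σ_t [a = v_{t+1}'] Y_t(s)`. [this work] -/
theorem tq5_s_dv0_ks (d' : Fin (5 + 7) → Fin (5 + 7) → Fin (5 + 7) → ZMod 2) (hd' : ∀ φ j k, d' φ j k = (∑ ψ, ∑ α, ∑ β', P ψ φ * P α j * P β' k * d ψ α β'))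
    (hdc' : ∀ φ j k, d' j φ k = d' φ j k)
    (hP0 : ∀ ψ, P ψ (Fin.castAdd 7 (0 : Fin 5)) = (Fin.append (Fin.cons (1) ((0 : Fin 4 → ZMod 2)) : Fin 5 → ZMod 2) ((0 : Fin 7 → ZMod 2)) : Fin (5 + 7) → ZMod 2) ψ)
    (hPv : ∀ ψ (i : Fin 4), P ψ (Fin.castAdd 7 (Fin.succ i)) = (Fin.append (Fin.cons (β i) (BC i) : Fin 5 → ZMod 2) ((0 : Fin 7 → ZMod 2)) : Fin (5 + 7) → ZMod 2) ψ)
    (hPz : ∀ ψ (j : Fin 7), P ψ (Fin.natAdd 5 j) = (Fin.append (Fin.cons (ε j) ((0 : Fin 4 → ZMod 2)) : Fin 5 → ZMod 2) (RC j) : Fin (5 + 7) → ZMod 2) ψ)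
    (hBω : ∀ i i' : Fin 4, (∑ t : Fin 4, ∑ t' : Fin 4, BC i t * BC i' t' * ((if (t = 0 ∧ t' = 1) ∨ (t = 1 ∧ t' = 0) then (1 : ZMod 2) else 0) + (if (t = 2 ∧ t' = 3) ∨ (t = 3 ∧ t' = 2) then (1 : ZMod 2) else 0))) = ((if (i = 0 ∧ i' = 1) ∨ (i = 1 ∧ i' = 0) then (1 : ZMod 2) else 0) + (if (i = 2 ∧ i' = 3) ∨ (i = 3 ∧ i' = 2) then (1 : ZMod 2) else 0)))
    (hBa : ∀ i : Fin 4, (∑ t : Fin 4, a t * BC i t) = if i = 0 then 1 else 0)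
    (hε : ∀ s : Fin 7, (∑ j : Fin 7, E j * RC s j) = ε s) :
    ∀ (a₁ : Fin 5) (s : Fin 7), d' (Fin.castAdd 7 1) (Fin.castAdd 7 a₁) (Fin.natAdd 5 s) =
      ∑ t : Fin 3, (if a₁ = Fin.natAdd 2 t then (∑ q : Fin 4, ∑ r : Fin 7, M q r * BC (Fin.succ t) q * RC s r) else 0) := by
  intro a₁ s
  rw [tq5_k1]
  simp only [tq5_knat]
  induction a₁ using Fin.cases with
  | zero => rw [hdc', hd', tq5_e_yvz d hds hdc hdd hF hzzz a Ξ hdΞ E M hdL BC RC β ε P 0 s hP0 hPv hPz]; simp [tq5_h0s5]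
  | succ i =>
    rw [hd', tq5_e_vvz d hds hdc hdd hF hzzz a Ξ hdΞ E M hdL BC RC β ε P 0 i s hPv hPz hBω hBa hε]
    simp only [Fin.succ_inj]
    induction i using Fin.cases with
    | zero => simp [tq5_h0s4, CharTwo.add_self_eq_zero]
    | succ t₀ => simp [Fin.succ_ne_zero, Finset.sum_ite_eq]

/-- Slice `hdv0_σσ`: `d'(v₀', z'_s, z'_u) = Ξ'_{su} = (Rᵀ Ξ R)_{su}`. [this work] -/
theorem tq5_s_dv0_ss (d' : Fin (5 + 7) → Fin (5 + 7) → Fin (5 + 7) → ZMod 2) (hd' : ∀ φ j k, d' φ j k = (∑ ψ, ∑ α, ∑ β', P ψ φ * P α j * P β' k * d ψ α β'))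
    (hPv : ∀ ψ (i : Fin 4), P ψ (Fin.castAdd 7 (Fin.succ i)) = (Fin.append (Fin.cons (β i) (BC i) : Fin 5 → ZMod 2) ((0 : Fin 7 → ZMod 2)) : Fin (5 + 7) → ZMod 2) ψ)
    (hPz : ∀ ψ (j : Fin 7), P ψ (Fin.natAdd 5 j) = (Fin.append (Fin.cons (ε j) ((0 : Fin 4 → ZMod 2)) : Fin 5 → ZMod 2) (RC j) : Fin (5 + 7) → ZMod 2) ψ)
    (hBa : ∀ i : Fin 4, (∑ t : Fin 4, a t * BC i t) = if i = 0 then 1 else 0) :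
    ∀ s u : Fin 7, d' (Fin.castAdd 7 1) (Fin.natAdd 5 s) (Fin.natAdd 5 u) = (∑ m : Fin 7, ∑ m' : Fin 7, Ξ m m' * RC s m * RC u m') := by
  intro s u
  rw [tq5_k1, hd', tq5_e_vzz d hds hdc hdd hF hzzz a Ξ hdΞ E M hdL BC RC β ε P 0 s u hPv hPz hBa]
  simp

/-- Slice `hdv_κκ`: `d'(v_{t+1}', κa, κb) = [{a,b} = {y, ω-partner}]`. [this work] -/
theorem tq5_s_dv_kk (d' : Fin (5 + 7) → Fin (5 + 7) → Fin (5 + 7) → ZMod 2) (hd' : ∀ φ j k, d' φ j k = (∑ ψ, ∑ α, ∑ β', P ψ φ * P α j * P β' k * d ψ α β'))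
    (hds' : ∀ φ j k, d' φ k j = d' φ j k)
    (hdc' : ∀ φ j k, d' j φ k = d' φ j k)
    (hP0 : ∀ ψ, P ψ (Fin.castAdd 7 (0 : Fin 5)) = (Fin.append (Fin.cons (1) ((0 : Fin 4 → ZMod 2)) : Fin 5 → ZMod 2) ((0 : Fin 7 → ZMod 2)) : Fin (5 + 7) → ZMod 2) ψ)
    (hPv : ∀ ψ (i : Fin 4), P ψ (Fin.castAdd 7 (Fin.succ i)) = (Fin.append (Fin.cons (β i) (BC i) : Fin 5 → ZMod 2) ((0 : Fin 7 → ZMod 2)) : Fin (5 + 7) → ZMod 2) ψ)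
    (hBω : ∀ i i' : Fin 4, (∑ t : Fin 4, ∑ t' : Fin 4, BC i t * BC i' t' * ((if (t = 0 ∧ t' = 1) ∨ (t = 1 ∧ t' = 0) then (1 : ZMod 2) else 0) + (if (t = 2 ∧ t' = 3) ∨ (t = 3 ∧ t' = 2) then (1 : ZMod 2) else 0))) = ((if (i = 0 ∧ i' = 1) ∨ (i = 1 ∧ i' = 0) then (1 : ZMod 2) else 0) + (if (i = 2 ∧ i' = 3) ∨ (i = 3 ∧ i' = 2) then (1 : ZMod 2) else 0)))
    (hβ : ∀ i i' i'' : Fin 4, (∑ t : Fin 4, ∑ t' : Fin 4, ∑ t'' : Fin 4, BC i t * BC i' t' * BC i'' t'' * d (Fin.castAdd 7 (Fin.succ t)) (Fin.castAdd 7 (Fin.succ t')) (Fin.castAdd 7 (Fin.succ t''))) + β i * ((if (i' = 0 ∧ i'' = 1) ∨ (i' = 1 ∧ i'' = 0) then (1 : ZMod 2) else 0) + (if (i' = 2 ∧ i'' = 3) ∨ (i' = 3 ∧ i'' = 2) then (1 : ZMod 2) else 0)) + β i' * ((if (i = 0 ∧ i'' = 1) ∨ (i = 1 ∧ i'' = 0)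 then (1 : ZMod 2) else 0) + (if (i = 2 ∧ i'' = 3) ∨ (i = 3 ∧ i'' = 2) then (1 : ZMod 2) else 0)) + β i'' * ((if (i = 0 ∧ i' = 1) ∨ (i = 1 ∧ i' = 0) then (1 : ZMod 2) else 0) + (if (i = 2 ∧ i' = 3) ∨ (i = 3 ∧ i' = 2) then (1 : ZMod 2) else 0)) = 0) :
    ∀ (t : Fin 3) (a₁ b₁ : Fin 5), d' (Fin.castAdd 7 (Fin.natAdd 2 t)) (Fin.castAdd 7 a₁) (Fin.castAdd 7 b₁) =
      if (a₁ = 0 ∧ b₁ = ![1, 4, 3] t) ∨ (a₁ = ![1, 4, 3] t ∧ b₁ = 0) then 1 else 0 := by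
  intro t a₁ b₁
  rw [tq5_knat t]
  induction a₁ using Fin.cases with
  | zero =>
    induction b₁ using Fin.cases with
    | zero => rw [hdc', hds', hd', tq5_e_yyv d hds hdc hdd hF hzzz a Ξ hdΞ E M hdL BC β P (Fin.succ t) hP0 hPv]; revert t; decide
    | succ i' => rw [hdc', hd', tq5_e_yvv d hds hdc hdd hF hzzz a Ξ hdΞ E M hdL BC β P (Fin.succ t) i' hP0 hPv hBω]; revert t i'; decide
  | succ i =>
    induction b₁ using Fin.cases with
    | zero => rw [hds', hdc', hd', tq5_e_yvv d hds hdc hdd hF hzzz a Ξ hdΞ E M hdL BC β P (Fin.succ t) i hP0 hPv hBω]; revert t i; decide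
    | succ i' => rw [hd', tq5_e_vvv d hds hdc hdd hF hzzz a Ξ hdΞ E M hdL BC β P (Fin.succ t) i i' hPv hBω hβ]; revert t i i'; decide

/-- Slice `hdv_κσ`: `d'(v_{t+1}', κa, z'_s) = [a = v₀'] Y_t(s)`. [this work] -/
theorem tq5_s_dv_ks (d' : Fin (5 + 7) → Fin (5 + 7) → Fin (5 + 7) → ZMod 2) (hd' : ∀ φ j k, d' φ j k = (∑ ψ, ∑ α, ∑ β', P ψ φ * P α j * P β' k * d ψ α β'))
    (hdc' : ∀ φ j k, d' j φ k = d' φ j k)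
    (hP0 : ∀ ψ, P ψ (Fin.castAdd 7 (0 : Fin 5)) = (Fin.append (Fin.cons (1) ((0 : Fin 4 → ZMod 2)) : Fin 5 → ZMod 2) ((0 : Fin 7 → ZMod 2)) : Fin (5 + 7) → ZMod 2) ψ)
    (hPv : ∀ ψ (i : Fin 4), P ψ (Fin.castAdd 7 (Fin.succ i)) = (Fin.append (Fin.cons (β i) (BC i) : Fin 5 → ZMod 2) ((0 : Fin 7 → ZMod 2)) : Fin (5 + 7) → ZMod 2) ψ)
    (hPz : ∀ ψ (j : Fin 7), P ψ (Fin.natAdd 5 j) = (Fin.append (Fin.cons (ε j) ((0 : Fin 4 → ZMod 2)) : Fin 5 → ZMod 2) (RC j) : Fin (5 + 7) → ZMod 2) ψ)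
    (hBω : ∀ i i' : Fin 4, (∑ t : Fin 4, ∑ t' : Fin 4, BC i t * BC i' t' * ((if (t = 0 ∧ t' = 1) ∨ (t = 1 ∧ t' = 0) then (1 : ZMod 2) else 0) + (if (t = 2 ∧ t' = 3) ∨ (t = 3 ∧ t' = 2) then (1 : ZMod 2) else 0))) = ((if (i = 0 ∧ i' = 1) ∨ (i = 1 ∧ i' = 0) then (1 : ZMod 2) else 0) + (if (i = 2 ∧ i' = 3) ∨ (i = 3 ∧ i' = 2) then (1 : ZMod 2) else 0)))
    (hBa : ∀ i : Fin 4, (∑ t : Fin 4, a t * BC i t) = if i = 0 then 1 else 0)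
    (hε : ∀ s : Fin 7, (∑ j : Fin 7, E j * RC s j) = ε s) :
    ∀ (t : Fin 3) (a₁ : Fin 5) (s : Fin 7), d' (Fin.castAdd 7 (Fin.natAdd 2 t)) (Fin.castAdd 7 a₁) (Fin.natAdd 5 s) =
      if a₁ = 1 then (∑ q : Fin 4, ∑ r : Fin 7, M q r * BC (Fin.succ t) q * RC s r) else 0 := by
  intro t a₁ s
  rw [tq5_knat t, tq5_k1]
  induction a₁ using Fin.cases with
  | zero => rw [hdc', hd', tq5_e_yvz d hds hdc hdd hF hzzz a Ξ hdΞ E M hdL BC RC β ε P (Fin.succ t) s hP0 hPv hPz]; simp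
  | succ i =>
    rw [hd', tq5_e_vvz d hds hdc hdd hF hzzz a Ξ hdΞ E M hdL BC RC β ε P (Fin.succ t) i s hPv hPz hBω hBa hε]
    simp only [Fin.succ_inj]
    by_cases hi : i = 0
    · subst hi; simp
    · simp [hi, Fin.succ_ne_zero]

/-- Slice `hdv_σσ`: `d'(v_{t+1}', z', z') = 0`. [this work] -/
theorem tq5_s_dv_ss (d' : Fin (5 + 7) → Fin (5 + 7) → Fin (5 + 7) → ZMod 2) (hd' : ∀ φ j k, d' φ j k = (∑ ψ, ∑ α, ∑ β', P ψ φ * P α j * P β' k * d ψ α β'))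
    (hPv : ∀ ψ (i : Fin 4), P ψ (Fin.castAdd 7 (Fin.succ i)) = (Fin.append (Fin.cons (β i) (BC i) : Fin 5 → ZMod 2) ((0 : Fin 7 → ZMod 2)) : Fin (5 + 7) → ZMod 2) ψ)
    (hPz : ∀ ψ (j : Fin 7), P ψ (Fin.natAdd 5 j) = (Fin.append (Fin.cons (ε j) ((0 : Fin 4 → ZMod 2)) : Fin 5 → ZMod 2) (RC j) : Fin (5 + 7) → ZMod 2) ψ)
    (hBa : ∀ i : Fin 4, (∑ t : Fin 4, a t * BC i t) = if i = 0 then 1 else 0) :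
    ∀ (t : Fin 3) (s u : Fin 7), d' (Fin.castAdd 7 (Fin.natAdd 2 t)) (Fin.natAdd 5 s) (Fin.natAdd 5 u) = 0 := by
  intro t s u
  rw [tq5_knat t, hd', tq5_e_vzz d hds hdc hdd hF hzzz a Ξ hdΞ E M hdL BC RC β ε P (Fin.succ t) s u hPv hPz hBa]
  simp [Fin.succ_ne_zero]

/-- Slice `hdz_κκ`: `d'(z'_j, κa, κb) = Σ_t [{a,b} = {v₀', v_{t+1}'}] Y_t(j)`. [this work] -/
theorem tq5_s_dz_kk (d' : Fin (5 + 7) → Fin (5 + 7) → Fin (5 + 7) → ZMod 2) (hd' : ∀ φ j k, d' φ j k = (∑ ψ, ∑ α, ∑ β', P ψ φ * P α j * P β' k * d ψ α β'))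
    (hds' : ∀ φ j k, d' φ k j = d' φ j k)
    (hdc' : ∀ φ j k, d' j φ k = d' φ j k)
    (hP0 : ∀ ψ, P ψ (Fin.castAdd 7 (0 : Fin 5)) = (Fin.append (Fin.cons (1) ((0 : Fin 4 → ZMod 2)) : Fin 5 → ZMod 2) ((0 : Fin 7 → ZMod 2)) : Fin (5 + 7) → ZMod 2) ψ)
    (hPv : ∀ ψ (i : Fin 4), P ψ (Fin.castAdd 7 (Fin.succ i)) = (Fin.append (Fin.cons (β i) (BC i) : Fin 5 → ZMod 2) ((0 : Fin 7 → ZMod 2)) : Fin (5 + 7) → ZMod 2) ψ)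
    (hPz : ∀ ψ (j : Fin 7), P ψ (Fin.natAdd 5 j) = (Fin.append (Fin.cons (ε j) ((0 : Fin 4 → ZMod 2)) : Fin 5 → ZMod 2) (RC j) : Fin (5 + 7) → ZMod 2) ψ)
    (hBω : ∀ i i' : Fin 4, (∑ t : Fin 4, ∑ t' : Fin 4, BC i t * BC i' t' * ((if (t = 0 ∧ t' = 1) ∨ (t = 1 ∧ t' = 0) then (1 : ZMod 2) else 0) + (if (t = 2 ∧ t' = 3) ∨ (t = 3 ∧ t' = 2) then (1 : ZMod 2) else 0))) = ((if (i = 0 ∧ i' = 1) ∨ (i = 1 ∧ i' = 0) then (1 : ZMod 2) else 0) + (if (i = 2 ∧ i' = 3) ∨ (i = 3 ∧ i' = 2) then (1 : ZMod 2) else 0)))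
    (hBa : ∀ i : Fin 4, (∑ t : Fin 4, a t * BC i t) = if i = 0 then 1 else 0)
    (hε : ∀ s : Fin 7, (∑ j : Fin 7, E j * RC s j) = ε s) :
    ∀ (j : Fin 7) (a₁ b₁ : Fin 5), d' (Fin.natAdd 5 j) (Fin.castAdd 7 a₁) (Fin.castAdd 7 b₁) =
      ∑ t : Fin 3, (if (a₁ = 1 ∧ b₁ = Fin.natAdd 2 t) ∨ (a₁ = Fin.natAdd 2 t ∧ b₁ = 1) then (∑ q : Fin 4, ∑ r : Fin 7, M q r * BC (Fin.succ t) q * RC j r) else 0) := by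
  intro j a₁ b₁
  rw [tq5_k1]
  simp only [tq5_knat]
  induction a₁ using Fin.cases with
  | zero =>
    induction b₁ using Fin.cases with
    | zero => rw [hdc', hds', hd', tq5_e_yyz d hds hdc hdd hF hzzz a Ξ hdΞ E M hdL RC ε P j hP0 hPz]; simp [tq5_h0s5]
    | succ i' => rw [hdc', hds', hd', tq5_e_yvz d hds hdc hdd hF hzzz a Ξ hdΞ E M hdL BC RC β ε P i' j hP0 hPv hPz]; simp [tq5_h0s5]
  | succ i =>
    induction b₁ using Fin.cases with
    | zero => rw [hds', hdc', hds', hd', tq5_e_yvz d hds hdc hdd hF hzzz a Ξ hdΞ E M hdL BC RC β ε P i j hP0 hPv hPz]; simp [tq5_h0s5]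
    | succ i' =>
      rw [hdc', hds', hd', tq5_e_vvz d hds hdc hdd hF hzzz a Ξ hdΞ E M hdL BC RC β ε P i i' j hPv hPz hBω hBa hε]
      simp only [Fin.succ_inj]
      induction i using Fin.cases with
      | zero =>
        induction i' using Fin.cases with
        | zero => simp [tq5_h0s4, CharTwo.add_self_eq_zero]
        | succ t₁ => simp [tq5_h0s4, Fin.succ_ne_zero, Finset.sum_ite_eq]
      | succ t₀ =>
        induction i' using Fin.cases with
        | zero => simp [tq5_h0s4, Fin.succ_ne_zero, Finset.sum_ite_eq]
        | succ t₁ => simp [Fin.succ_ne_zero]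

/-- Slice `hdz_κσ`: `d'(z'_j, κa, z'_s) = [a = v₀'] Ξ'_{js}`. [this work] -/
theorem tq5_s_dz_ks (d' : Fin (5 + 7) → Fin (5 + 7) → Fin (5 + 7) → ZMod 2) (hd' : ∀ φ j k, d' φ j k = (∑ ψ, ∑ α, ∑ β', P ψ φ * P α j * P β' k * d ψ α β'))
    (hdc' : ∀ φ j k, d' j φ k = d' φ j k)
    (hP0 : ∀ ψ, P ψ (Fin.castAdd 7 (0 : Fin 5)) = (Fin.append (Fin.cons (1) ((0 : Fin 4 → ZMod 2)) : Fin 5 → ZMod 2) ((0 : Fin 7 → ZMod 2)) : Fin (5 + 7) → ZMod 2) ψ)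
    (hPv : ∀ ψ (i : Fin 4), P ψ (Fin.castAdd 7 (Fin.succ i)) = (Fin.append (Fin.cons (β i) (BC i) : Fin 5 → ZMod 2) ((0 : Fin 7 → ZMod 2)) : Fin (5 + 7) → ZMod 2) ψ)
    (hPz : ∀ ψ (j : Fin 7), P ψ (Fin.natAdd 5 j) = (Fin.append (Fin.cons (ε j) ((0 : Fin 4 → ZMod 2)) : Fin 5 → ZMod 2) (RC j) : Fin (5 + 7) → ZMod 2) ψ)
    (hBa : ∀ i : Fin 4, (∑ t : Fin 4, a t * BC i t) = if i = 0 then 1 else 0) :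
    ∀ (j : Fin 7) (a₁ : Fin 5) (s : Fin 7), d' (Fin.natAdd 5 j) (Fin.castAdd 7 a₁) (Fin.natAdd 5 s) =
      if a₁ = 1 then (∑ m : Fin 7, ∑ m' : Fin 7, Ξ m m' * RC j m * RC s m') else 0 := by
  intro j a₁ s
  rw [tq5_k1]
  induction a₁ using Fin.cases with
  | zero => rw [hdc', hd', tq5_e_yzz d hds hdc hdd hF hzzz a Ξ hdΞ E M hdL RC ε P j s hP0 hPz]; simp
  | succ i =>
    rw [hdc', hd', tq5_e_vzz d hds hdc hdd hF hzzz a Ξ hdΞ E M hdL BC RC β ε P i j s hPv hPz hBa]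
    simp only [Fin.succ_inj]
    by_cases hi : i = 0
    · subst hi; simp
    · simp [hi]

/-- Slice `hdz_σσ`: `d'(z', z', z') = 0`. [this work] -/
theorem tq5_s_dz_ss (d' : Fin (5 + 7) → Fin (5 + 7) → Fin (5 + 7) → ZMod 2) (hd' : ∀ φ j k, d' φ j k = (∑ ψ, ∑ α, ∑ β', P ψ φ * P α j * P β' k * d ψ α β'))
    (hPz : ∀ ψ (j : Fin 7), P ψ (Fin.natAdd 5 j) = (Fin.append (Fin.cons (ε j) ((0 : Fin 4 → ZMod 2)) : Fin 5 → ZMod 2) (RC j) : Fin (5 + 7) → ZMod 2) ψ) :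
    ∀ j s u : Fin 7, d' (Fin.natAdd 5 j) (Fin.natAdd 5 s) (Fin.natAdd 5 u) = 0 := by
  intro j s u
  rw [hd', tq5_e_zzz d hds hdc hdd hF hzzz a Ξ hdΞ E M hdL RC ε P j s u hPz]

end Slices

end Summit.QuantumAdvantage.QuantumAdvantage.Theorems.CubicForrelation.NearExactIsExact
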